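import Summits.Ventures.QEC.Census.CertCheckBZ
import HarnessLib

/-!
# Cover reduction for two-sheeted covers of CSS codes: fibre sums, lifts and the fibre decomposition
# (qec cell, lane ε of director-qec R29; census/search-9/cover/README.md §2, §4 L-cov / L-push)

When a CSS code `C` on `n` qubits is a TWO-SHEETED COVER of a CSS code `C̄` on `n̄` qubits — a 2-to-1 map `π` of the
qubits such that the fibre sum `P` (push-forward, `(P v)_p = v_{π⁻¹p,0} + v_{π⁻¹p,1}`) carries every `H^X` row of `C`
to an `H^X` row of `C̄` and every `H^Z` row to an `H^Z` row (the abelian two-block codes over a group `G` and their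
quotients by an element of order `2`: `[[288,12,18]] → [[144,12,12]] → [[72,12,6]]`) — every `Z`-type vector `v` of
`C` decomposes UNIQUELY as `v = lift₀ (P v) ⊕ P* y` with `|v| = |P v| + 2·|full fibres|`, its `H^X`-syndrome is
`H^X lift₀(Pv) ⊕ P_G*(H̄^X y)` and its pairing with any `X`-logical `ℓ` is `⟨ℓ, lift₀(Pv)⟩ + ⟨P ℓ, y⟩`. This turns
«no non-trivial `Z`-logical of weight `≤ W`» for `C` into finitely many SMALL affine («coset») low-weight
enumerations over `C̄` indexed by the low-weight words of `P(ker H^X)` (README §3: for `[[288,12,18]]`, 856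
problems and `1.85·10⁸` selections instead of `1.7·10¹³`).

THIS FILE (definitions + the elementary lemmas, all on binary numerals = the checker's words, bit `q` = qubit `q`):
* `mkBits m f` — the numeral with bit `i < m` equal to `f i` (`testBit_mkBits`);
* `Cover2` — the index tables of a two-sheeted cover (`f0 p`, `f1 p` = the two qubits over `p`; `qmap q` = the image
  of `q`) and its structural check `Cover2.ok`;
* `push` (`P`), `pull` (`P*`), `lift0` (sheet-0 lift), `ypart` (the `y` of the decomposition), `dbl` (full fibres),
  with their `testBit` characterisations;
* `decomp` : `lift0 (push v) ^^^ pull (ypart v) = v`; `testBit_dbl` : full fibres = bits of `ypart v` off `push v`;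
* `push_xor` / `pull_xor` (linearity); `popc_and_pull` (adjointness `⟨a, P* y⟩ = ⟨P a, y⟩`, as overlap parities);
  `popc_eq_push_add_two_dbl` (the weight identity `|v| = |P v| + 2·|dbl v|`).
The syndrome / row-space transport from ROW TABLES (`pushRowsOK`), the coset-enumeration checker and the level
theorems are the sibling files `CertCoverCoset.lean` / `CertCoverSound.lean`.

HONEST FRAMING: generic plumbing, no code and no distance is mentioned; everything is `decide`-evaluable structural
recursion on `ℕ`/`List`. No instances, no notation.
-/

namespace Summit.Ventures.QEC.Census

/-! ## Numerals from bit predicates -/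

/-- The numeral whose bit `i` is `f i` for `i < m` and `0` beyond: `mkBits (m+1) f = [f 0] + 2 · mkBits m (f ∘ succ)`.
(definition, structural on `m`) -/
def mkBits : ℕ → (ℕ → Bool) → ℕ
  | 0, _ => 0
  | m + 1, f => (if f 0 then 1 else 0) + 2 * mkBits m (fun i => f (i + 1))

/-- Bit `i` of `mkBits m f` is `f i` below `m` and `false` from `m` on. -/
theorem testBit_mkBits : ∀ (m : ℕ) (f : ℕ → Bool) (i : ℕ), (mkBits m f).testBit i = (decide (i < m) && f i)
  | 0, f, i => by simp [mkBits]
  | m + 1, f, 0 => by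
    rw [mkBits, Nat.testBit_zero]
    cases f 0 <;> simp [Nat.add_mul_mod_self_left]
  | m + 1, f, i + 1 => by
    have hdiv : ((if f 0 then 1 else 0) + 2 * mkBits m (fun i => f (i + 1))) / 2 = mkBits m (fun i => f (i + 1)) := by
      have h1 : (if f 0 then 1 else 0) ≤ 1 := by split <;> omega
      omega
    rw [mkBits, Nat.testBit_succ, hdiv, testBit_mkBits m]
    by_cases h : i < m
    · simp [h, Nat.succ_lt_succ h]
    · have h' : ¬ (i + 1 < m + 1) := fun h' => h (Nat.lt_of_succ_lt_succ h')
      simp [h, h']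

/-- `mkBits m f < 2^m`. -/
theorem mkBits_lt : ∀ (m : ℕ) (f : ℕ → Bool), mkBits m f < 2 ^ m
  | 0, _ => by simp [mkBits]
  | m + 1, f => by
    have h := mkBits_lt m (fun i => f (i + 1))
    have h1 : (if f 0 then 1 else 0) ≤ 1 := by split <;> omega
    rw [mkBits, pow_succ]
    omega

/-- Bits of `mkBits m f` at or beyond `m` are unset. -/
theorem testBit_mkBits_of_le {m i : ℕ} (f : ℕ → Bool) (h : m ≤ i) : (mkBits m f).testBit i = false := by
  rw [testBit_mkBits]; simp [Nat.not_lt.2 h]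

/-- Bits of `mkBits m f` below `m`. -/
theorem testBit_mkBits_of_lt {m i : ℕ} (f : ℕ → Bool) (h : i < m) : (mkBits m f).testBit i = f i := by
  rw [testBit_mkBits]; simp [h]

/-! ## Two-sheeted covers by index tables -/

/-- The index tables of a two-sheeted cover `π : [0,n) → [0,nq)`: `f0[p]`, `f1[p]` are the two qubits over the
small qubit `p` (sheet 0, sheet 1) and `qmap[q]` is the image of the big qubit `q`. Consistency is `Cover2.ok`. -/
structure Cover2 where
  /-- number of qubits upstairs -/
  n : ℕ
  /-- number of qubits downstairs -/
  nq : ℕ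
  /-- sheet-0 preimage of each small qubit -/
  f0 : List ℕ
  /-- sheet-1 preimage of each small qubit -/
  f1 : List ℕ
  /-- image of each big qubit -/
  qmap : List ℕ

namespace Cover2

variable (c : Cover2)

/-- Sheet-0 preimage of `p` (junk `0` out of range). -/
def F0 (p : ℕ) : ℕ := c.f0.getD p 0

/-- Sheet-1 preimage of `p` (junk `0` out of range). -/
def F1 (p : ℕ) : ℕ := c.f1.getD p 0

/-- Image of `q` (junk `0` out of range). -/
def Q (q : ℕ) : ℕ := c.qmap.getD q 0

/-- Structural check of the tables: lengths; over every `p < nq` two DISTINCT qubits `< n` mapping to `p`; every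
`q < n` maps below `nq` and is one of the two qubits over its image. (So the fibres `{f0 p, f1 p}` partition `[0,n)`.)
(definition) -/
def ok : Bool :=
  (c.f0.length == c.nq) && (c.f1.length == c.nq) && (c.qmap.length == c.n) &&
    ((List.range c.nq).all fun p =>
      decide (c.F0 p < c.n) && decide (c.F1 p < c.n) && !(c.F0 p == c.F1 p) &&
        (c.Q (c.F0 p) == p) && (c.Q (c.F1 p) == p)) &&
    ((List.range c.n).all fun q => decide (c.Q q < c.nq) && ((c.F0 (c.Q q) == q) || (c.F1 (c.Q q) == q)))

/-- Push-forward (fibre sum) `P`: bit `p` of `push v` = bit `f0 p` of `v` XOR bit `f1 p` of `v`. (definition) -/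
def push (v : ℕ) : ℕ := mkBits c.nq fun p => xor (v.testBit (c.F0 p)) (v.testBit (c.F1 p))

/-- Pull-back `P*`: bit `q` of `pull y` = bit `qmap q` of `y` (the full fibres over `supp y`). (definition) -/
def pull (y : ℕ) : ℕ := mkBits c.n fun q => y.testBit (c.Q q)

/-- Sheet-0 lift: bit `q` of `lift0 u` is set iff `q` is the sheet-0 qubit over its image and that image is in
`u`. (definition) -/
def lift0 (u : ℕ) : ℕ := mkBits c.n fun q => (c.F0 (c.Q q) == q) && u.testBit (c.Q q)

/-- The `y`-part of the fibre decomposition: bit `p` of `ypart v` = bit `f1 p` of `v` (sheet-1 occupancy).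
(definition) -/
def ypart (v : ℕ) : ℕ := mkBits c.nq fun p => v.testBit (c.F1 p)

/-- Full fibres: bit `p` of `dbl v` is set iff both qubits over `p` are in `v`. (definition) -/
def dbl (v : ℕ) : ℕ := mkBits c.nq fun p => v.testBit (c.F0 p) && v.testBit (c.F1 p)

/-! ### Unpacking the structural check -/

section Ok

variable {c} (h : c.ok = true)
include h

/-- From `ok`: the sheet-0 qubit over `p < nq` is `< n`. -/
theorem F0_lt {p : ℕ} (hp : p < c.nq) : c.F0 p < c.n := by
  simp only [ok, Bool.and_eq_true, List.all_eq_true, List.mem_range, decide_eq_true_eq] at h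
  exact (h.1.2 p hp).1.1.1.1

/-- From `ok`: the sheet-1 qubit over `p < nq` is `< n`. -/
theorem F1_lt {p : ℕ} (hp : p < c.nq) : c.F1 p < c.n := by
  simp only [ok, Bool.and_eq_true, List.all_eq_true, List.mem_range, decide_eq_true_eq] at h
  exact (h.1.2 p hp).1.1.1.2

/-- From `ok`: the two qubits over `p` are distinct. -/
theorem F0_ne_F1 {p : ℕ} (hp : p < c.nq) : c.F0 p ≠ c.F1 p := by
  simp only [ok, Bool.and_eq_true, List.all_eq_true, List.mem_range, decide_eq_true_eq, Bool.not_eq_true',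
    beq_eq_false_iff_ne] at h
  exact (h.1.2 p hp).1.1.2

/-- From `ok`: `qmap (f0 p) = p`. -/
theorem Q_F0 {p : ℕ} (hp : p < c.nq) : c.Q (c.F0 p) = p := by
  simp only [ok, Bool.and_eq_true, List.all_eq_true, List.mem_range, decide_eq_true_eq, beq_iff_eq] at h
  exact (h.1.2 p hp).1.2

/-- From `ok`: `qmap (f1 p) = p`. -/
theorem Q_F1 {p : ℕ} (hp : p < c.nq) : c.Q (c.F1 p) = p := by
  simp only [ok, Bool.and_eq_true, List.all_eq_true, List.mem_range, decide_eq_true_eq, beq_iff_eq] at h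
  exact (h.1.2 p hp).2

/-- From `ok`: the image of `q < n` is `< nq`. -/
theorem Q_lt {q : ℕ} (hq : q < c.n) : c.Q q < c.nq := by
  simp only [ok, Bool.and_eq_true, List.all_eq_true, List.mem_range, decide_eq_true_eq] at h
  exact (h.2 q hq).1

/-- From `ok`: every `q < n` is the sheet-0 or the sheet-1 qubit over its image. -/
theorem F0_Q_or_F1_Q {q : ℕ} (hq : q < c.n) : c.F0 (c.Q q) = q ∨ c.F1 (c.Q q) = q := by
  simp only [ok, Bool.and_eq_true, List.all_eq_true, List.mem_range, decide_eq_true_eq, Bool.or_eq_true,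
    beq_iff_eq] at h
  exact (h.2 q hq).2

end Ok

/-! ### Bit characterisations -/

/-- Bits of `push`. -/
theorem testBit_push {p : ℕ} (hp : p < c.nq) (v : ℕ) :
    (c.push v).testBit p = xor (v.testBit (c.F0 p)) (v.testBit (c.F1 p)) := by
  rw [push, testBit_mkBits_of_lt _ hp]

/-- Bits of `pull`. -/
theorem testBit_pull {q : ℕ} (hq : q < c.n) (y : ℕ) : (c.pull y).testBit q = y.testBit (c.Q q) := by
  rw [pull, testBit_mkBits_of_lt _ hq]

/-- Bits of `lift0`. -/
theorem testBit_lift0 {q : ℕ} (hq : q < c.n) (u : ℕ) :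
    (c.lift0 u).testBit q = ((c.F0 (c.Q q) == q) && u.testBit (c.Q q)) := by
  rw [lift0, testBit_mkBits_of_lt _ hq]

/-- Bits of `ypart`. -/
theorem testBit_ypart {p : ℕ} (hp : p < c.nq) (v : ℕ) : (c.ypart v).testBit p = v.testBit (c.F1 p) := by
  rw [ypart, testBit_mkBits_of_lt _ hp]

/-- Bits of `dbl`. -/
theorem testBit_dbl {p : ℕ} (hp : p < c.nq) (v : ℕ) :
    (c.dbl v).testBit p = (v.testBit (c.F0 p) && v.testBit (c.F1 p)) := by
  rw [dbl, testBit_mkBits_of_lt _ hp]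

/-- `push v < 2^nq`. -/
theorem push_lt (v : ℕ) : c.push v < 2 ^ c.nq := mkBits_lt _ _

/-- `pull y < 2^n`. -/
theorem pull_lt (y : ℕ) : c.pull y < 2 ^ c.n := mkBits_lt _ _

/-- `lift0 u < 2^n`. -/
theorem lift0_lt (u : ℕ) : c.lift0 u < 2 ^ c.n := mkBits_lt _ _

/-- `ypart v < 2^nq`. -/
theorem ypart_lt (v : ℕ) : c.ypart v < 2 ^ c.nq := mkBits_lt _ _

/-- `dbl v < 2^nq`. -/
theorem dbl_lt (v : ℕ) : c.dbl v < 2 ^ c.nq := mkBits_lt _ _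

/-! ### Linearity -/

/-- `push` is additive: `P (a ⊕ b) = P a ⊕ P b`. -/
theorem push_xor (a b : ℕ) : c.push (a ^^^ b) = c.push a ^^^ c.push b := by
  apply Nat.eq_of_testBit_eq; intro p
  rw [Nat.testBit_xor]
  by_cases hp : p < c.nq
  · rw [c.testBit_push hp, c.testBit_push hp, c.testBit_push hp, Nat.testBit_xor, Nat.testBit_xor]
    cases a.testBit (c.F0 p) <;> cases a.testBit (c.F1 p) <;> cases b.testBit (c.F0 p) <;>
      cases b.testBit (c.F1 p) <;> rfl
  · rw [push, push, push, testBit_mkBits_of_le _ (Nat.not_lt.1 hp), testBit_mkBits_of_le _ (Nat.not_lt.1 hp),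
      testBit_mkBits_of_le _ (Nat.not_lt.1 hp)]
    rfl

/-- `pull` is additive: `P* (a ⊕ b) = P* a ⊕ P* b`. -/
theorem pull_xor (a b : ℕ) : c.pull (a ^^^ b) = c.pull a ^^^ c.pull b := by
  apply Nat.eq_of_testBit_eq; intro q
  rw [Nat.testBit_xor]
  by_cases hq : q < c.n
  · rw [c.testBit_pull hq, c.testBit_pull hq, c.testBit_pull hq, Nat.testBit_xor]
  · rw [pull, pull, pull, testBit_mkBits_of_le _ (Nat.not_lt.1 hq), testBit_mkBits_of_le _ (Nat.not_lt.1 hq),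
      testBit_mkBits_of_le _ (Nat.not_lt.1 hq)]
    rfl

/-! ### The fibre decomposition -/

/-- **Fibre decomposition** (README §2, L-cov): for a word `v` on the `n` big qubits,
`v = lift₀ (P v) ⊕ P* (ypart v)` — the fibres met once are lifted through sheet 0 and corrected by `ypart`, the full
fibres are the pull-back part. -/
theorem decomp {c : Cover2} (h : c.ok = true) {v : ℕ} (hv : v < 2 ^ c.n) :
    c.lift0 (c.push v) ^^^ c.pull (c.ypart v) = v := by
  apply Nat.eq_of_testBit_eq; intro q
  rw [Nat.testBit_xor]
  by_cases hq : q < c.n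
  · have hQ := Q_lt h hq
    rw [c.testBit_lift0 hq, c.testBit_pull hq, c.testBit_push hQ, c.testBit_ypart hQ]
    rcases F0_Q_or_F1_Q h hq with h0 | h1
    · rw [h0]
      simp only [beq_self_eq_true, Bool.true_and]
      cases v.testBit q <;> cases v.testBit (c.F1 (c.Q q)) <;> rfl
    · have hne : (c.F0 (c.Q q) == q) = false := by
        rw [beq_eq_false_iff_ne]; intro h0; exact F0_ne_F1 h hQ (h0.trans h1.symm)
      rw [hne, h1]
      simp
  · rw [lift0, pull, testBit_mkBits_of_le _ (Nat.not_lt.1 hq), testBit_mkBits_of_le _ (Nat.not_lt.1 hq)]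
    rw [Nat.testBit_lt_two_pow (lt_of_lt_of_le hv (Nat.pow_le_pow_right (by norm_num) (Nat.not_lt.1 hq)))]
    rfl

/-- The full fibres are exactly the bits of `ypart v` outside `push v` (downstairs, bit `p < nq`). -/
theorem testBit_dbl_eq {c : Cover2} {p : ℕ} (hp : p < c.nq) (v : ℕ) :
    (c.dbl v).testBit p = ((c.ypart v).testBit p && !(c.push v).testBit p) := by
  rw [c.testBit_dbl hp, c.testBit_ypart hp, c.testBit_push hp]
  cases v.testBit (c.F0 p) <;> cases v.testBit (c.F1 p) <;> rfl

/-- `push` of a pull-back vanishes: `P (P* y) = 0` (two equal sheets cancel). -/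
theorem push_pull {c : Cover2} (h : c.ok = true) (y : ℕ) : c.push (c.pull y) = 0 := by
  apply Nat.eq_of_testBit_eq; intro p
  rw [Nat.zero_testBit]
  by_cases hp : p < c.nq
  · rw [c.testBit_push hp, c.testBit_pull (F0_lt h hp), c.testBit_pull (F1_lt h hp), Q_F0 h hp, Q_F1 h hp]
    cases y.testBit p <;> rfl
  · rw [push, testBit_mkBits_of_le _ (Nat.not_lt.1 hp)]

/-- `push` of a sheet-0 lift is the identity below `2^nq`: `P (lift₀ u) = u`. -/
theorem push_lift0 {c : Cover2} (h : c.ok = true) {u : ℕ} (hu : u < 2 ^ c.nq) : c.push (c.lift0 u) = u := by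
  apply Nat.eq_of_testBit_eq; intro p
  by_cases hp : p < c.nq
  · rw [c.testBit_push hp, c.testBit_lift0 (F0_lt h hp), c.testBit_lift0 (F1_lt h hp), Q_F0 h hp, Q_F1 h hp]
    have hne : (c.F0 p == c.F1 p) = false := by rw [beq_eq_false_iff_ne]; exact F0_ne_F1 h hp
    rw [hne]
    simp
  · rw [push, testBit_mkBits_of_le _ (Nat.not_lt.1 hp),
      Nat.testBit_lt_two_pow (lt_of_lt_of_le hu (Nat.pow_le_pow_right (by norm_num) (Nat.not_lt.1 hp)))]

/-! ### Fibre double counting, the weight identity and adjointness -/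

/-- **Fibre double counting**: summing over the big qubits is summing over the small qubits both sheets. -/
theorem sum_fiber {c : Cover2} (h : c.ok = true) (g : ℕ → ℕ) :
    ∑ q : Fin c.n, g q = ∑ p : Fin c.nq, (g (c.F0 p) + g (c.F1 p)) := by
  let e : Fin c.nq ⊕ Fin c.nq → Fin c.n := fun s =>
    match s with
    | Sum.inl p => ⟨c.F0 p, F0_lt h p.2⟩
    | Sum.inr p => ⟨c.F1 p, F1_lt h p.2⟩
  have he : Function.Bijective e := by
    constructor
    · rintro (p | p) (p' | p') hpp
      · have hv : c.F0 p = c.F0 p' := by simpa [e, Fin.ext_iff] using hpp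
        have := congrArg c.Q hv
        rw [Q_F0 h p.2, Q_F0 h p'.2] at this
        exact congrArg Sum.inl (Fin.ext this)
      · have hv : c.F0 p = c.F1 p' := by simpa [e, Fin.ext_iff] using hpp
        have := congrArg c.Q hv
        rw [Q_F0 h p.2, Q_F1 h p'.2] at this
        exact absurd (this ▸ hv) (F0_ne_F1 h p'.2)
      · have hv : c.F1 p = c.F0 p' := by simpa [e, Fin.ext_iff] using hpp
        have := congrArg c.Q hv
        rw [Q_F1 h p.2, Q_F0 h p'.2] at this
        exact absurd (this ▸ hv).symm (F0_ne_F1 h p'.2)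
      · have hv : c.F1 p = c.F1 p' := by simpa [e, Fin.ext_iff] using hpp
        have := congrArg c.Q hv
        rw [Q_F1 h p.2, Q_F1 h p'.2] at this
        exact congrArg Sum.inr (Fin.ext this)
    · intro q
      rcases F0_Q_or_F1_Q h q.2 with h0 | h1
      · exact ⟨Sum.inl ⟨c.Q q, Q_lt h q.2⟩, Fin.ext h0⟩
      · exact ⟨Sum.inr ⟨c.Q q, Q_lt h q.2⟩, Fin.ext h1⟩
  rw [← Fintype.sum_bijective e he (fun s => g (e s)) (fun q => g q) (fun _ => rfl), Fintype.sum_sum_type,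
    Finset.sum_add_distrib]

/-- **Weight identity** (README §2): `|v| = |P v| + 2 · |dbl v|` — fibres met once count once (in `P v`), full
fibres twice. -/
theorem popc_eq_push_add_two_dbl {c : Cover2} (h : c.ok = true) (v : ℕ) :
    popc c.n v = popc c.nq (c.push v) + 2 * popc c.nq (c.dbl v) := by
  rw [popc_eq_sum, popc_eq_sum, popc_eq_sum, sum_fiber h (fun q => (v.testBit q).toNat), Finset.mul_sum,
    ← Finset.sum_add_distrib]
  refine Finset.sum_congr rfl fun p _ => ?_
  rw [c.testBit_push p.2, c.testBit_dbl p.2]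
  cases v.testBit (c.F0 p) <;> cases v.testBit (c.F1 p) <;> rfl

/-- **Adjointness** `⟨a, P* y⟩ = ⟨P a, y⟩` as overlap parities: `|a ∩ P* y| ≡ |P a ∩ y| (mod 2)`. -/
theorem popc_and_pull_mod_two {c : Cover2} (h : c.ok = true) (a y : ℕ) :
    popc c.n (a &&& c.pull y) % 2 = popc c.nq (c.push a &&& y) % 2 := by
  rw [popc_eq_sum, popc_eq_sum, sum_fiber h (fun q => ((a &&& c.pull y).testBit q).toNat), Finset.sum_nat_mod,
    Finset.sum_nat_mod (s := Finset.univ) (f := fun i : Fin c.nq => ((c.push a &&& y).testBit i).toNat)]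
  congr 1
  refine Finset.sum_congr rfl fun p _ => ?_
  rw [Nat.testBit_and, Nat.testBit_and, Nat.testBit_and, c.testBit_pull (F0_lt h p.2),
    c.testBit_pull (F1_lt h p.2), Q_F0 h p.2, Q_F1 h p.2, c.testBit_push p.2]
  cases a.testBit (c.F0 p) <;> cases a.testBit (c.F1 p) <;> cases y.testBit p <;> rfl

/-- The weight of a pull-back is twice the weight downstairs: `|P* y| = 2|y|`. -/
theorem popc_pull {c : Cover2} (h : c.ok = true) (y : ℕ) : popc c.n (c.pull y) = 2 * popc c.nq y := by
  rw [popc_eq_push_add_two_dbl h, push_pull h, popc_zero, zero_add]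
  congr 1
  rw [popc_eq_sum, popc_eq_sum]
  refine Finset.sum_congr rfl fun p _ => ?_
  rw [c.testBit_dbl p.2, c.testBit_pull (F0_lt h p.2), c.testBit_pull (F1_lt h p.2), Q_F0 h p.2, Q_F1 h p.2,
    Bool.and_self]

end Cover2

/-! ## Control: the trivial double cover of two qubits by four -/

/-- Toy cover `[0,4) → [0,2)`: fibres `{0,2} ↦ 0`, `{1,3} ↦ 1` (sheet 0 = qubits `0,1`, sheet 1 = qubits `2,3`). -/
def toyCover2 : Cover2 := { n := 4, nq := 2, f0 := [0, 1], f1 := [2, 3], qmap := [0, 1, 0, 1] }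

/-- The toy tables are consistent. -/
theorem toyCover2_ok : toyCover2.ok = true := by decide

/-- On the toy cover: `P 0b0111 = 0b10` (fibre `0` met twice cancels, fibre `1` once), `P* 0b01 = 0b0101`,
`lift₀ 0b11 = 0b0011`, `ypart 0b0111 = 0b01`, `dbl 0b0111 = 0b01`, and the decomposition `0b0111 = lift₀ 0b10 ⊕ P* 0b01`. -/
theorem toyCover2_values : toyCover2.push 7 = 2 ∧ toyCover2.pull 1 = 5 ∧ toyCover2.lift0 3 = 3 ∧
    toyCover2.ypart 7 = 1 ∧ toyCover2.dbl 7 = 1 ∧ (toyCover2.lift0 2 ^^^ toyCover2.pull 1 = 7) := by decide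

end Summit.Ventures.QEC.Census
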